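import Literature.Geometry.Kaehler.ComplexTorusKunnethDiagonalDivisorFormula
import Literature.Geometry.Kaehler.ComplexTorusInverseLefschetzKleiman
import HarnessLib

/-!
# Scholl's correspondence `f_i` inverts the hard Lefschetz isomorphism of a complex torus
# (Milne 1999, Rem. 5.11 — the operator clause — read in cohomology at torus level)

Layer `Literature/Geometry/Kaehler`, namespace `Literature.Geometry.Kaehler.ComplexTorus`; lane `lit-hodgefound`
(Track 2 foundations library), Layer A4, prover seat `lit-hodgefound-p08` (generation 11, self-proposed row g11-#2
«(g11-#1 `ComplexTorusKunnethDiagonalDivisorFormula`)⁺ · (g7-#3 `ComplexTorusInverseLefschetzKleiman`)⁺ · Q383⁺ ·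
A4-47/Lange (6.6)⁺»). Sequel, BY NAME, of `ComplexTorusKunnethDiagonalDivisorFormula` (g11-#1: Scholl's explicit
divisor polynomials `p_i`, `f_i` in the graded ring `GForm (E × E) ℂ` of invariant forms on `X × X`, and the identity
`f_i · (of 2 p₁^*θ)^{g-i} = ((-1)ⁱ c/g!) • of (2g) π_i`, `π_i = K_i[Δ_X]`,
`schollF_mul_of_fst_pow_eq_smul_of_kunnethComponent_cycleForm_diagonal`), of `ComplexTorusCorrespondenceComposition`
(A4-47⁺: Lange's literal action (6.6) `corrAct`, `γ(y) = p_{2*}(γ ∧ p₁^*y)`), of `ComplexTorusKunnethDiagonalProjectors`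
(Q383: `π_s` acts as the identity on `Hˢ(X)`, `corrAct_kunnethComponent_cycleForm_diagonal_cast`) and of
`ComplexTorusInverseLefschetzKleiman` (g7-#3: Kleiman's `Λᵗ = kleimanDualPow η m t : H^{m+2t}(X) → Hᵐ(X)` and
`eq_kleimanDualPow_of_leftInverse`: for `m + t = g` every left inverse of the hard Lefschetz isomorphism
`Lᵗ = lefschetzPow η t : Hᵐ ⥲ H^{m+2t}` is `Λᵗ`).

## Source, verbatim

J. S. Milne, *Lefschetz classes on abelian varieties*, Duke Math. J. **96** (1999) 639–675, held
`paper:doi-10-1215-s0012-7094-99-09620-5`, p. 665 (p0027 L54–L79): "**Remark 5.11.** The referee points out that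
it is possible to show similarly that the correspondences `Λ`, `ᶜΛ`, `*` etc. are Lefschetz for rational
equivalence. Following (Scholl 1994, 5.9), define for `0 ≤ i ≤ 2g`,
`f_i = Σ_{max(0,i-g) ≤ j ≤ i/2} (1/(j!(g-i+j)!(i-2j)!)) p^*([Dʲ]) · q^*([Dʲ]) · [M]^{i-2j}`.
Then `f_i` is Lefschetz, and `((-1)ⁱ/√deg(λ_D)) f_i` is the inverse of the strong Lefschetz isomorphism
'cup with `[D]^{g-i}`' (cf. ib. 5.9.1)." Here `D` is a symmetric ample divisor on the abelian variety `A` of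
dimension `g`, `M = m^*D - p^*D - q^*D`, `λ_D` the polarisation of `D` (proof of Thm. 5.10, same page).

## What is proved (torus level; theorems only, no definitions, no named facts)

For a complex torus `X = E/Φ(ℤ^ι)` of dimension `g` (`e : Fin 2g ≃ ι` an enumeration of the lattice basis,
`vol_X = volumeForm Φ e`, independent of `e`), a real invariant `2`-form `ξ` with `θ := ofRealForm ξ`,
`θ^{∧g} = c · vol_X`, and `i + t = g`; `f_i` is Scholl's sum above with `[D] ↦ θ`, `[M] ↦ μ := m^*θ - p₁^*θ - p₂^*θ`,
computed in `GForm (E × E) ℂ` and READ IN DEGREE `2i = i + i` (an invariant `2i`-form on `X × X`, a correspondence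
of degree `i - g`), acting on `H(X)` by Lange's (6.6) `f(y) = p_{2*}(f ∧ p₁^*y)` (`corrAct`); `Lᵗ = lefschetzPow ξ t`
is `x ↦ θ^{∧t} ∧ x : Hⁱ(X) → H^{i+2t}(X) = H^{2g-i}(X)`.

* §0 `pushforwardFst_finCongr_trans` (`p_{2*}` along a cast of the first block) and the projection-formula
  identity **`corrAct_wedge_domDomCongr`: `γ(β ∧ x) = (γ ∧ p₁^*β)(x)`** for every `γ ∈ H(X₁ × X₂)`,
  `β, x ∈ H(X₁)` (associativity and naturality of `∧`).
* §1 **`corrAct_schollF_lefschetzPow`: `f_i(Lᵗ x) = ((-1)ⁱ c/g!) · x` for every `x ∈ Hⁱ(X)`** — from §0,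
  g11-#1's `f_i · p₁^*θ^{∧t} = ((-1)ⁱ c/g!) · π_i` read in degree `2g` (`IsHomog.eq_of`, `of_mul_of`), and Q383's
  `π_i = id` on `Hⁱ(X)`; as linear maps `corrAct_schollF_comp_lefschetzPow`: `f_i ∘ Lᵗ = ((-1)ⁱ c/g!) · id`.
* §2 **`smul_corrAct_schollF_eq_kleimanDualPow`: `((-1)ⁱ g!/c) · f_i(·) = Λᵗ = kleimanDualPow ξ i t`** for `ξ`
  non-degenerate and `c ≠ 0` — Kleiman's inverse Lefschetz operator `Λ^{g-i} : H^{2g-i}(X) → Hⁱ(X)` (g7-#3: a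
  polynomial in `L` and `ᶜΛ`, the inverse of `L^{g-i}`) IS the action of Scholl's explicit algebraic correspondence.
* §3 the polarised torus (`hη : IsRiemannForm Φ η` of type `(d₁, …, d_g)`, `ω = c₁(L) = ofRealForm (-η)`,
  `ω^{∧g} = g!·d₁⋯d_g·vol_X`, so `c/g! = d₁⋯d_g = √deg(λ_L)`), IN MILNE'S PRINTED NORMALISATION:
  **`IsRiemannForm.smul_corrAct_schollF_lefschetzPow`: `((-1)ⁱ/(d₁⋯d_g)) · f_i(L^{g-i} x) = x`** on `Hⁱ(X)` and
  **`IsRiemannForm.smul_corrAct_schollF_eq_kleimanDualPow`: `((-1)ⁱ/(d₁⋯d_g)) · f_i(·) = Λ^{g-i}`**.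

NOT here: Chow groups / rational equivalence (Milne's `f_i ∈ CH(A × A)`; we work with its cohomology class on the
torus); the clause "`f_i` is Lefschetz" (its three generators `p₁^*θ`, `p₂^*θ`, `μ` are divisor classes; cf. g7-#1
`ComplexTorusGraphClassesLefschetz` for `π_i ∈ Dᵍ(X × X)`); the operators `ᶜΛ`, `*`.

## References

* [Milne1999LefschetzClasses] J. S. Milne, *Lefschetz classes on abelian varieties*, Duke Math. J. 96 (1999),
  §5 Rem. 5.11 (p. 665), Thm. 5.10 (proof).
* [Scholl1994ClassicalMotives] A. J. Scholl, *Classical motives*, in: Motives (Seattle 1991), Proc. Sympos. Pure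
  Math. 55.1 (1994) 163–187, §5 (5.9), (5.9.1) (cited through Milne; not held — acq-10063 names Künnemann 1993).
* [Kleiman1968AlgebraicCycles] S. L. Kleiman, *Algebraic cycles and the Weil conjectures*, in: Dix exposés sur la
  cohomologie des schémas (1968), §1.4 (the operators `Λ`, `ᶜΛ`).
* [Lange2023AbelianVarietiesComplex] H. Lange, *Abelian Varieties over the Complex Numbers* (2023), §6.2.2 (6.6)
  p. 303 (the action of a correspondence), §6.2.4 (6.10) p. 310 (`p_{2*}`), §7.3.2 (the Lefschetz operator).
-/

noncomputable section

open scoped Manifold ContDiff Topology Real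
open Set Function Complex Finset Module
open Literature.LinearAlgebra.Alternating
open Literature.LinearAlgebra.Alternating.GForm (of IsHomog)

namespace Literature.Geometry.Kaehler

namespace ComplexTorus

/-! ### §0 Toolkit: `p_{2*}` along a re-read first block; the action of a correspondence on a cup product -/

section Toolkit

variable {ι₁ ι₂ : Type*} [Fintype ι₁] [Fintype ι₂] [DecidableEq ι₁] [DecidableEq ι₂]
  {E₁ E₂ : Type*} [NormedAddCommGroup E₁] [NormedSpace ℂ E₁] [NormedAddCommGroup E₂] [NormedSpace ℂ E₂]
  (Φ₁ : (ι₁ → ℝ) ≃L[ℝ] E₁) (Φ₂ : (ι₂ → ℝ) ≃L[ℝ] E₂)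

/-- `p_{2*}` computed along an enumeration of the lattice basis of `X₁` re-read through a cast of the first
block of arguments is `p_{2*}` of the re-indexed form (`p_{2*}` does not depend on the enumeration).
[cite: Lange2023AbelianVarietiesComplex, §6.2.4 (6.10) p. 310] -/
theorem pushforwardFst_finCongr_trans {N₁ N₁' l : ℕ} (h : N₁' = N₁) (e₁ : Fin N₁ ≃ ι₁)
    (θ : (E₁ × E₂) [⋀^Fin (N₁ + l)]→L[ℝ] ℂ) :
    pushforwardFst Φ₁ Φ₂ ((finCongr h).trans e₁) (θ.domDomCongr (finCongr (by omega))) =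
      pushforwardFst Φ₁ Φ₂ e₁ θ := by
  subst h
  rw [domDomCongr_finCongr_self]
  exact pushforwardFst_eq_pushforwardFst Φ₁ Φ₂ _ _ θ

/-- **The action of a correspondence on a cup product with a pulled-back class: `γ(β ∧ x) = (γ ∧ p₁^*β)(x)`**
for Lange's literal action (6.6) `γ(y) = p_{2*}(γ ∧ p₁^*y)`: `p_{2*}(γ ∧ p₁^*(β ∧ x)) = p_{2*}((γ ∧ p₁^*β) ∧ p₁^*x)`
by the naturality and the associativity of `∧` (all degree casts explicit; any enumerations `e₁`, `e₂` of the
lattice basis of `X₁`). [cite: Lange2023AbelianVarietiesComplex, §6.2.2 (6.6) p. 303] -/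
theorem corrAct_wedge_domDomCongr {a d l p k d₂ : ℕ} (e₁ : Fin (k + d) ≃ ι₁) (e₂ : Fin (a + d₂) ≃ ι₁)
    (γ : (E₁ × E₂) [⋀^Fin (d + l)]→L[ℝ] ℂ) (β : E₁ [⋀^Fin p]→L[ℝ] ℂ) (x : E₁ [⋀^Fin a]→L[ℝ] ℂ)
    (h : p + a = k) (h₂ : (d + l) + p = d₂ + l) :
    corrAct Φ₁ Φ₂ e₁ γ ((β.wedge x).domDomCongr (finCongr h)) =
      corrAct Φ₁ Φ₂ e₂
        ((γ.wedge (β.compContinuousLinearMap (ContinuousLinearMap.fst ℝ E₁ E₂))).domDomCongr (finCongr h₂)) x := by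
  subst h
  obtain rfl : d₂ = d + p := by omega
  have H : a + (d + p) = (p + a) + d := by omega
  rw [domDomCongr_finCongr_self, corrAct_eq_of_enum Φ₁ Φ₂ e₂ ((finCongr H).trans e₁), corrAct_apply,
    corrAct_apply, ← pushforwardFst_finCongr_trans Φ₁ Φ₂ H e₁]
  congr 1
  rw [ContinuousAlternatingMap.wedge_compContinuousLinearMap, wedge_wedge_eq_domDomCongr_assoc₃,
    domDomCongr_finCongr_trans, domDomCongr_finCongr_trans, domDomCongr_finCongr_wedge,
    domDomCongr_finCongr_trans]

end Toolkit

/-! ### §1 `f_i ∘ Lᵗ = ((-1)ⁱ c/g!) · id` on `Hⁱ(X)` (`i + t = g`) -/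

section Operator

variable {ι : Type*} [Fintype ι] [DecidableEq ι] {E : Type*} [NormedAddCommGroup E] [NormedSpace ℂ E]
  (Φ : (ι → ℝ) ≃L[ℝ] E) {g : ℕ} (e : Fin (2 * g) ≃ ι) {ξ : E [⋀^Fin 2]→L[ℝ] ℝ}

/-- **THEOREM (Milne 1999, Rem. 5.11, operator clause, at torus level): Scholl's correspondence `f_i` composed
with the hard Lefschetz map `Lᵗ`, `i + t = g`, is `((-1)ⁱ c/g!)` times the identity of `Hⁱ(X)`.** For a complex
torus `X = E/Φ(ℤ^ι)` of dimension `g`, ANY real invariant `2`-form `ξ` with `θ^{∧g} = c · vol_X` (`θ := ofRealForm ξ`;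
any enumeration `e` of the lattice basis) and every `x ∈ Hⁱ(X)`:
`f_i(Lᵗ x) = f_i(θ^{∧t} ∧ x) = ((-1)ⁱ c/g!) · x`, where
`f_i := Σ_{max(0,i-g) ≤ j ≤ i/2} (1/(j!(g-i+j)!(i-2j)!)) (of 2 p₁^*θ)^j (of 2 p₂^*θ)^j (of 2 μ)^{i-2j}`
(`μ = m^*θ - p₁^*θ - p₂^*θ`) is read as an invariant `2i`-form on `X × X` and acts by Lange's (6.6)
`f(y) = p_{2*}(f ∧ p₁^*y)` — because `f_i(θ^{∧t} ∧ x) = (f_i ∧ p₁^*θ^{∧t})(x)` (`corrAct_wedge_domDomCongr`),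
`f_i ∧ p₁^*θ^{∧(g-i)} = ((-1)ⁱ c/g!) · π_i` (g11-#1) and `π_i = K_i[Δ_X]` acts as the identity on `Hⁱ(X)` (Q383).
[cite: Milne1999LefschetzClasses, §5 Rem. 5.11] -/
theorem corrAct_schollF_lefschetzPow {c : ℂ} (hξ : wedgePow (ofRealForm ξ) g = c • volumeForm Φ e) {i t : ℕ}
    (hit : i + t = g) (h : 2 * t + i = i + 2 * t) (e₁ : Fin ((i + 2 * t) + i) ≃ ι) (x : E [⋀^Fin i]→L[ℝ] ℂ) :
    corrAct Φ Φ e₁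
          ((∑ j ∈ Finset.Icc (i - g) (i / 2),
            ((Nat.factorial j * Nat.factorial (g + j - i) * Nat.factorial (i - 2 * j) : ℕ) : ℂ)⁻¹ •
              ((of 2 ((ofRealForm ξ).compContinuousLinearMap (ContinuousLinearMap.fst ℝ E E)) : GForm (E × E) ℂ) ^ j *
                of 2 ((ofRealForm ξ).compContinuousLinearMap (ContinuousLinearMap.snd ℝ E E)) ^ j *
                of 2 (((ofRealForm ξ).compContinuousLinearMap (ContinuousLinearMap.fst ℝ E E +
                    ContinuousLinearMap.snd ℝ E E)) -
                  ((ofRealForm ξ).compContinuousLinearMap (ContinuousLinearMap.fst ℝ E E)) -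
                  ((ofRealForm ξ).compContinuousLinearMap (ContinuousLinearMap.snd ℝ E E))) ^ (i - 2 * j)) :
            GForm (E × E) ℂ) (i + i))
        (lefschetzPow ξ t h x) =
      ((-1) ^ i * c / Nat.factorial g : ℂ) • x := by
  -- a positively oriented enumeration and the diagonal datum of `X` (auxiliary)
  obtain ⟨e₀, he₀⟩ := exists_orientationSign_eq_one Φ e
  rw [volumeForm_eq_volumeForm Φ e e₀] at hξ
  have e' : Fin (2 * g + 2 * g) ≃ ι ⊕ ι := finSumFinEquiv.symm.trans (e₀.sumCongr e₀)
  set F : GForm (E × E) ℂ := ∑ j ∈ Finset.Icc (i - g) (i / 2),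
      ((Nat.factorial j * Nat.factorial (g + j - i) * Nat.factorial (i - 2 * j) : ℕ) : ℂ)⁻¹ •
        ((of 2 ((ofRealForm ξ).compContinuousLinearMap (ContinuousLinearMap.fst ℝ E E)) : GForm (E × E) ℂ) ^ j *
          of 2 ((ofRealForm ξ).compContinuousLinearMap (ContinuousLinearMap.snd ℝ E E)) ^ j *
          of 2 (((ofRealForm ξ).compContinuousLinearMap (ContinuousLinearMap.fst ℝ E E +
              ContinuousLinearMap.snd ℝ E E)) -
            ((ofRealForm ξ).compContinuousLinearMap (ContinuousLinearMap.fst ℝ E E)) -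
            ((ofRealForm ξ).compContinuousLinearMap (ContinuousLinearMap.snd ℝ E E))) ^ (i - 2 * j)) with hFdef
  -- Rem. 5.11 in the graded ring (g11-#1): `f_i · (of 2 p₁^*θ)^t = ((-1)ⁱ c/g!) • of (2g) π_i`
  have H := schollF_mul_of_fst_pow_eq_smul_of_kunnethComponent_cycleForm_diagonal Φ e₀ he₀ e' (ofRealForm ξ) hξ
    (i := i) (by omega)
  rw [show g - i = t by omega, ← hFdef] at H
  -- `f_i` is homogeneous of degree `2i = i + i`
  have hF : IsHomog (i + i) F := by
    refine GForm.IsHomog.sum _ fun j hj ↦ ?_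
    obtain ⟨-, hj2⟩ := Finset.mem_Icc.mp hj
    have hji : 2 * j ≤ i := by omega
    have hm := isHomog_monomial (ofRealForm ξ) j j (i - 2 * j)
    rw [show 2 * j + 2 * j + 2 * (i - 2 * j) = i + i by omega] at hm
    exact hm.smul _
  -- read the identity in degree `(i + 2t) + i = 2g`: `(f_i ∧ p₁^*θ^{∧t}) = ((-1)ⁱ c/g!) · π_i` as forms
  have hk : 2 * g = (i + 2 * t) + i := by omega
  have h₂ : (i + i) + 2 * t = (i + 2 * t) + i := by omega
  have HN := congrFun H ((i + 2 * t) + i)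
  rw [hF.eq_of, of_two_pow_eq_of_wedgePow, GForm.of_mul_of, ← GForm.of_domDomCongr_finCongr h₂,
    GForm.of_apply_self, Pi.smul_apply, ← GForm.of_domDomCongr_finCongr hk, GForm.of_apply_self,
    ← wedgePow_compContinuousLinearMap] at HN
  -- the operator computation: `f_i(θ^{∧t} ∧ x) = (f_i ∧ p₁^*θ^{∧t})(x) = ((-1)ⁱ c/g!) π_i(x) = ((-1)ⁱ c/g!) x`
  have e₂ : Fin (i + (i + 2 * t)) ≃ ι := (finCongr (by omega)).trans e₁
  rw [lefschetzPow_apply, corrAct_wedge_domDomCongr Φ Φ e₁ e₂ (F (i + i)) (wedgePow (ofRealForm ξ) t) x h h₂,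
    HN, corrAct_smul, LinearMap.smul_apply,
    corrAct_kunnethComponent_cycleForm_diagonal_cast Φ e₀ he₀ e' e₂ hk x i, if_pos rfl]

/-- `f_i ∘ Lᵗ = ((-1)ⁱ c/g!) · id` as an identity of linear maps `Hⁱ(X) → Hⁱ(X)` (`i + t = g`).
[cite: Milne1999LefschetzClasses, §5 Rem. 5.11] -/
theorem corrAct_schollF_comp_lefschetzPow {c : ℂ} (hξ : wedgePow (ofRealForm ξ) g = c • volumeForm Φ e)
    {i t : ℕ} (hit : i + t = g) (h : 2 * t + i = i + 2 * t) (e₁ : Fin ((i + 2 * t) + i) ≃ ι) :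
    corrAct Φ Φ e₁
          ((∑ j ∈ Finset.Icc (i - g) (i / 2),
            ((Nat.factorial j * Nat.factorial (g + j - i) * Nat.factorial (i - 2 * j) : ℕ) : ℂ)⁻¹ •
              ((of 2 ((ofRealForm ξ).compContinuousLinearMap (ContinuousLinearMap.fst ℝ E E)) : GForm (E × E) ℂ) ^ j *
                of 2 ((ofRealForm ξ).compContinuousLinearMap (ContinuousLinearMap.snd ℝ E E)) ^ j *
                of 2 (((ofRealForm ξ).compContinuousLinearMap (ContinuousLinearMap.fst ℝ E E +
                    ContinuousLinearMap.snd ℝ E E)) -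
                  ((ofRealForm ξ).compContinuousLinearMap (ContinuousLinearMap.fst ℝ E E)) -
                  ((ofRealForm ξ).compContinuousLinearMap (ContinuousLinearMap.snd ℝ E E))) ^ (i - 2 * j)) :
            GForm (E × E) ℂ) (i + i)) ∘ₗ
        lefschetzPow ξ t h =
      ((-1) ^ i * c / Nat.factorial g : ℂ) • LinearMap.id :=
  LinearMap.ext fun x ↦ by
    rw [LinearMap.comp_apply, corrAct_schollF_lefschetzPow Φ e hξ hit h e₁ x, LinearMap.smul_apply,
      LinearMap.id_apply]

end Operator

/-! ### §2 `((-1)ⁱ g!/c) · f_i = Λᵗ`: Kleiman's inverse Lefschetz operator is the action of Scholl's correspondence -/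

section Kleiman

variable {ι : Type*} [Fintype ι] [DecidableEq ι] {E : Type*} [NormedAddCommGroup E] [NormedSpace ℂ E]
  [FiniteDimensional ℂ E] (Φ : (ι → ℝ) ≃L[ℝ] E) {g : ℕ} (e : Fin (2 * g) ≃ ι) {ξ : E [⋀^Fin 2]→L[ℝ] ℝ}

/-- **THEOREM (Milne 1999, Rem. 5.11: "`((-1)ⁱ/√deg(λ_D)) f_i` is the inverse of the strong Lefschetz isomorphism
'cup with `[D]^{g-i}`' (cf. ib. 5.9.1)"; "… the correspondences `Λ`, `ᶜΛ`, `*` etc. are Lefschetz"), at torus level: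
`((-1)ⁱ g!/c) · f_i(·) = Λᵗ : H^{i+2t}(X) → Hⁱ(X)`, `i + t = g`.** For a non-degenerate real invariant `2`-form `ξ`
with `θ^{∧g} = c · vol_X`, `c ≠ 0`, the action (6.6) of Scholl's explicit divisor-polynomial correspondence `f_i`,
rescaled by `(-1)ⁱ g!/c`, IS Kleiman's iterated dual Lefschetz operator `Λᵗ = kleimanDualPow ξ i t` — the inverse
of the hard Lefschetz isomorphism `Lᵗ : Hⁱ(X) ⥲ H^{2g-i}(X)`, a polynomial in `L` and `ᶜΛ` (g7-#3
`eq_kleimanDualPow_of_leftInverse`: every left inverse of `Lᵗ` on `Hⁱ`, `i + t = g`, is `Λᵗ`).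
[cite: Milne1999LefschetzClasses, §5 Rem. 5.11] [cite: Kleiman1968AlgebraicCycles, §1.4] -/
theorem smul_corrAct_schollF_eq_kleimanDualPow {c : ℂ} (hξ : wedgePow (ofRealForm ξ) g = c • volumeForm Φ e)
    (hc : c ≠ 0) (hnd : ∀ v : E, v ≠ 0 → ∃ w : E, ξ ![v, w] ≠ 0) {i t : ℕ} (hit : i + t = g)
    (e₁ : Fin ((i + 2 * t) + i) ≃ ι) :
    ((-1) ^ i * Nat.factorial g / c : ℂ) •
        corrAct Φ Φ e₁
          ((∑ j ∈ Finset.Icc (i - g) (i / 2),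
            ((Nat.factorial j * Nat.factorial (g + j - i) * Nat.factorial (i - 2 * j) : ℕ) : ℂ)⁻¹ •
              ((of 2 ((ofRealForm ξ).compContinuousLinearMap (ContinuousLinearMap.fst ℝ E E)) : GForm (E × E) ℂ) ^ j *
                of 2 ((ofRealForm ξ).compContinuousLinearMap (ContinuousLinearMap.snd ℝ E E)) ^ j *
                of 2 (((ofRealForm ξ).compContinuousLinearMap (ContinuousLinearMap.fst ℝ E E +
                    ContinuousLinearMap.snd ℝ E E)) -
                  ((ofRealForm ξ).compContinuousLinearMap (ContinuousLinearMap.fst ℝ E E)) -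
                  ((ofRealForm ξ).compContinuousLinearMap (ContinuousLinearMap.snd ℝ E E))) ^ (i - 2 * j)) :
            GForm (E × E) ℂ) (i + i)) =
      kleimanDualPow ξ i t := by
  have hfr : i + t = finrank ℂ E := by have := finrank_complex_mul_two Φ e; omega
  refine eq_kleimanDualPow_of_leftInverse hnd hfr (by omega) _ fun y ↦ ?_
  have hg : (Nat.factorial g : ℂ) ≠ 0 := Nat.cast_ne_zero.2 (Nat.factorial_ne_zero g)
  rw [LinearMap.smul_apply, corrAct_schollF_lefschetzPow Φ e hξ hit _ e₁ y, smul_smul,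
    show ((-1) ^ i * Nat.factorial g / c : ℂ) * ((-1) ^ i * c / Nat.factorial g) =
        ((-1 : ℂ) ^ i * (-1) ^ i) * ((Nat.factorial g * c) / (Nat.factorial g * c)) by ring,
    ← pow_add, ← two_mul, pow_mul, neg_one_sq, one_pow, one_mul, div_self (mul_ne_zero hg hc), one_smul]

end Kleiman

/-! ### §3 The polarised torus: `((-1)ⁱ/(d₁⋯d_g)) · f_i` inverts `L^{g-i} = c₁(L)^{∧(g-i)} ∧ ·` -/

section Polarised

variable {ι : Type*} [Fintype ι] [DecidableEq ι] {E : Type*} [NormedAddCommGroup E] [NormedSpace ℂ E]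
  (Φ : (ι → ℝ) ≃L[ℝ] E) {g : ℕ} {η : E [⋀^Fin 2]→L[ℝ] ℝ}

/-- **Rem. 5.11 for a polarised complex torus, in the printed normalisation:
`((-1)ⁱ/√deg(λ_L)) · f_i(L^{g-i} x) = x` on `Hⁱ(X)`**, `√deg(λ_L) = d₁⋯d_g` for a polarisation of type
`(d₁, …, d_g)` with Riemann form `η`, `ω = c₁(L) = ofRealForm (-η)` (`ω^{∧g} = g!·d₁⋯d_g·vol_X`,
`IsRiemannForm.torusIntegral_wedgePow_neg_of_isPolarizationType`), `L^{g-i} = lefschetzPow (-η) t` (`i + t = g`)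
= "cup with `[D]^{g-i}`", `f_i` Scholl's correspondence in `ω`, acting by (6.6).
[cite: Milne1999LefschetzClasses, §5 Rem. 5.11] -/
theorem IsRiemannForm.smul_corrAct_schollF_lefschetzPow (hη : IsRiemannForm Φ η) {d : Fin g → ℕ}
    (hd : IsPolarizationType Φ η d) {i t : ℕ} (hit : i + t = g) (h : 2 * t + i = i + 2 * t)
    (e₁ : Fin ((i + 2 * t) + i) ≃ ι) (x : E [⋀^Fin i]→L[ℝ] ℂ) :
    ((-1 : ℂ) ^ i / ∏ k, (d k : ℂ)) •
        corrAct Φ Φ e₁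
          ((∑ j ∈ Finset.Icc (i - g) (i / 2),
            ((Nat.factorial j * Nat.factorial (g + j - i) * Nat.factorial (i - 2 * j) : ℕ) : ℂ)⁻¹ •
              ((of 2 ((ofRealForm (-η)).compContinuousLinearMap (ContinuousLinearMap.fst ℝ E E)) : GForm (E × E) ℂ) ^ j *
                of 2 ((ofRealForm (-η)).compContinuousLinearMap (ContinuousLinearMap.snd ℝ E E)) ^ j *
                of 2 (((ofRealForm (-η)).compContinuousLinearMap (ContinuousLinearMap.fst ℝ E E +
                    ContinuousLinearMap.snd ℝ E E)) -
                  ((ofRealForm (-η)).compContinuousLinearMap (ContinuousLinearMap.fst ℝ E E)) -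
                  ((ofRealForm (-η)).compContinuousLinearMap (ContinuousLinearMap.snd ℝ E E))) ^ (i - 2 * j)) :
            GForm (E × E) ℂ) (i + i))
          (lefschetzPow (-η) t h x) =
      x := by
  have e : Fin (2 * g) ≃ ι := (finCongr (by omega)).trans e₁
  have hθ : wedgePow (ofRealForm (-η)) g = ((Nat.factorial g : ℂ) * ∏ k, (d k : ℂ)) • volumeForm Φ e := by
    have h1 := eq_torusIntegral_smul_volumeForm Φ e (wedgePow (ofRealForm (-η)) g)
    rwa [hη.torusIntegral_wedgePow_neg_of_isPolarizationType Φ hd e] at h1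
  rw [corrAct_schollF_lefschetzPow Φ e hθ hit h e₁ x, smul_smul]
  have hD : (∏ k, (d k : ℂ)) ≠ 0 :=
    Finset.prod_ne_zero_iff.2 fun k _ ↦ Nat.cast_ne_zero.2 (hd.pos hη k).ne'
  have hg : (Nat.factorial g : ℂ) ≠ 0 := Nat.cast_ne_zero.2 (Nat.factorial_ne_zero g)
  rw [show ((-1 : ℂ) ^ i / ∏ k, (d k : ℂ)) * ((-1) ^ i * ((Nat.factorial g : ℂ) * ∏ k, (d k : ℂ)) /
          Nat.factorial g) =
        ((-1 : ℂ) ^ i * (-1) ^ i) * (((Nat.factorial g : ℂ) * ∏ k, (d k : ℂ)) / ((∏ k, (d k : ℂ)) *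
          Nat.factorial g)) by ring,
    ← pow_add, ← two_mul, pow_mul, neg_one_sq, one_pow, one_mul, mul_comm (Nat.factorial g : ℂ),
    div_self (mul_ne_zero hD hg), one_smul]

/-- **`((-1)ⁱ/(d₁⋯d_g)) · f_i(·) = Λ^{g-i}`** for a polarised complex torus of type `(d₁, …, d_g)`: Kleiman's
inverse Lefschetz operator `Λᵗ : H^{2g-i}(X) → Hⁱ(X)` (`i + t = g`) of `ω = c₁(L)` is the action of the explicit
algebraic correspondence `((-1)ⁱ/√deg(λ_L)) f_i` ("Then `f_i` is Lefschetz, and `((-1)ⁱ/√deg(λ_D)) f_i` is the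
inverse of the strong Lefschetz isomorphism"). [cite: Milne1999LefschetzClasses, §5 Rem. 5.11] -/
theorem IsRiemannForm.smul_corrAct_schollF_eq_kleimanDualPow [FiniteDimensional ℂ E] (hη : IsRiemannForm Φ η)
    {d : Fin g → ℕ} (hd : IsPolarizationType Φ η d) {i t : ℕ} (hit : i + t = g)
    (e₁ : Fin ((i + 2 * t) + i) ≃ ι) :
    ((-1 : ℂ) ^ i / ∏ k, (d k : ℂ)) •
        corrAct Φ Φ e₁
          ((∑ j ∈ Finset.Icc (i - g) (i / 2),
            ((Nat.factorial j * Nat.factorial (g + j - i) * Nat.factorial (i - 2 * j) : ℕ) : ℂ)⁻¹ •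
              ((of 2 ((ofRealForm (-η)).compContinuousLinearMap (ContinuousLinearMap.fst ℝ E E)) : GForm (E × E) ℂ) ^ j *
                of 2 ((ofRealForm (-η)).compContinuousLinearMap (ContinuousLinearMap.snd ℝ E E)) ^ j *
                of 2 (((ofRealForm (-η)).compContinuousLinearMap (ContinuousLinearMap.fst ℝ E E +
                    ContinuousLinearMap.snd ℝ E E)) -
                  ((ofRealForm (-η)).compContinuousLinearMap (ContinuousLinearMap.fst ℝ E E)) -
                  ((ofRealForm (-η)).compContinuousLinearMap (ContinuousLinearMap.snd ℝ E E))) ^ (i - 2 * j)) :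
            GForm (E × E) ℂ) (i + i)) =
      kleimanDualPow (-η) i t := by
  have hfr : i + t = finrank ℂ E := by have := finrank_complex_mul_two Φ e₁; omega
  have hnd : ∀ v : E, v ≠ 0 → ∃ w : E, (-η) ![v, w] ≠ 0 := fun v hv ↦ by
    obtain ⟨w, hw⟩ := hη.exists_apply_ne_zero Φ v hv
    exact ⟨w, by rwa [ContinuousAlternatingMap.neg_apply, neg_ne_zero]⟩
  exact eq_kleimanDualPow_of_leftInverse hnd hfr (by omega) _ fun y ↦ by
    rw [LinearMap.smul_apply, hη.smul_corrAct_schollF_lefschetzPow Φ hd hit _ e₁ y]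

end Polarised

end ComplexTorus

end Literature.Geometry.Kaehler
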